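import Mathlib
import Summits.ValiantsHypothesis.ValiantsHypothesis.Theorems.NewtonUnitEquationsDissociatedUniformTotalsLaw
import Summits.ValiantsHypothesis.ValiantsHypothesis.Theorems.NewtonUnitEquationsDissociatedUniformTotalsLawUnion
import Summits.ValiantsHypothesis.ValiantsHypothesis.Theorems.NewtonUnitEquationsDissociatedUniformTotalsLawIntervalUnionLinear
import HarnessLib

/-!
# Crux `NewtonUnitEquations.DissociatedUniform` (stmt-ValiantsHypothesis-5905), `n = 3` totals law of model (Q**):
# the union bound for CYCLIC ARCS `{t, t+d, …, t+(m−1)d}` in an ARBITRARY finite abelian group — `#vert conv U_s(arc) ≤ 40·|G|`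

`…TotalsLawIntervalUnionLinear` proved the interval union bound in `ℤ/q` (`IntervalUnionVertBound 24`).  The crux lives over an
arbitrary finite abelian group `G`; the natural analogue of a cyclic window there is a CYCLIC ARC `cycArc t d m = {t + i•d : i < m}` —
an arithmetic progression of any step `d` (of any order), e.g. a window of `ℤ/q` (`d = 1`), a unit-step progression (`d` a
generator), a progression of NON-invertible step in `ℤ/q`, or a window of a cyclic factor of a product group.  For ALL `a b : G → ℝ²`:
* `unionVert_cycArc_le : unionVert a b (cycArc t d m) s ≤ 40·|G|` (pointwise, every class, every arc);
* `unionTotal_cycArc_le : unionTotal a b (cycArc t d m) ≤ 40·|G|²`;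
* `classVert_le_of_arc_levels` / `totalVert_le_of_arc_levels`: a third curve with `≤ k` values whose level sets are cyclic arcs
  (any base points, any steps) has `V_s ≤ 40k|G|` for EVERY class and `T(a,b,c) ≤ 40k|G|²`, with `a, b` arbitrary.

Mechanism (reduction to windows of one length).  Write `H = ⟨d⟩` (order `o`), enumerate the cosets `G/H` (`arcKey`), pick
representatives (`arcRep`, via `Quotient.out`) and positions (`arcPos`: `c = rep + n•d`, `n < o`); UNROLL all cosets into one
sequence `arcSeq b d : ℕ → ℝ²`, coset `k` occupying the stretch `[3ok, 3ok + 3o)` read along `d`.  Then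
`U_s(arc) = ⋃_x (a x + arcSeq[L_x, L_x + m))` is a union of `|G|` translated windows OF ONE LENGTH with starts `< 3o·[G:H] = 3|G|`
(`unionPts_cycArc_eq`, Lagrange), and `…IntervalUnionLinear.ncard_extremePoints_windows_le_linear` (block decomposition into
staircases + the staircase hull bound of `…TotalsLawStaircase`) gives `8|G| + 8m(3|G|/m + 1) ≤ 40|G|`.
Honest label: a stratum theorem (arc position sets / arc-valued third curves, arbitrary pairs); `UnionTotalsLaw C` and
`TotalsLawThree C` remain OPEN and are asserted nowhere; nothing here bears on VP ≠ VNP. [folklore]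
-/

set_option linter.dupNamespace false -- `ValiantsHypothesis.ValiantsHypothesis` (summit = problem) in every name

open Finset
open scoped Pointwise

namespace Summit.ValiantsHypothesis.ValiantsHypothesis.Theorems.NewtonUnitEquationsDissociatedUniform

namespace TotalsLaw

/-! ### Cyclic arcs `{t, t+d, …, t+(m-1)d}` in an arbitrary finite abelian group -/

section ArcSet

variable {G : Type*} [AddCommGroup G] [DecidableEq G]

/-- The CYCLIC ARC `{t, t + d, t + 2d, …, t + (m-1)d}` of step `d` in a finite abelian group (in `ℤ/q` with `d = 1`: the cyclic
window `[t, t+m)`; with `d` a unit: an automorphic image of a window; in general an arithmetic progression of any step). -/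
def cycArc (t d : G) (m : ℕ) : Finset G := (Finset.range m).image fun i : ℕ => t + i • d

/-- Membership in a cyclic arc. [folklore] -/
theorem mem_cycArc {t d : G} {m : ℕ} {g : G} : g ∈ cycArc t d m ↔ ∃ i, i < m ∧ t + i • d = g := by
  rw [cycArc, Finset.mem_image]
  constructor
  · rintro ⟨i, hi, h⟩; exact ⟨i, Finset.mem_range.1 hi, h⟩
  · rintro ⟨i, hi, h⟩; exact ⟨i, Finset.mem_range.2 hi, h⟩

/-- An arc of at least `ord(d)` steps is the whole coset arc of `ord(d)` steps. [folklore] -/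
theorem cycArc_eq_of_le (t d : G) {m : ℕ} (hm : addOrderOf d ≤ m) (hd : 0 < addOrderOf d) :
    cycArc t d m = cycArc t d (addOrderOf d) := by
  ext g
  rw [mem_cycArc, mem_cycArc]
  constructor
  · rintro ⟨i, -, rfl⟩
    exact ⟨i % addOrderOf d, Nat.mod_lt _ hd, by rw [mod_addOrderOf_nsmul]⟩
  · rintro ⟨i, hi, rfl⟩
    exact ⟨i, lt_of_lt_of_le hi hm, rfl⟩

end ArcSet

section ArcCosets

variable {G : Type*} [AddCommGroup G] [Fintype G]

/-- The index (`< [G : ⟨d⟩]`) of the coset of `⟨d⟩` containing `c`. -/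
noncomputable def arcKey (d c : G) : ℕ :=
  (Finite.equivFin (G ⧸ AddSubgroup.zmultiples d) (QuotientAddGroup.mk c : G ⧸ AddSubgroup.zmultiples d)).val

/-- A representative of the coset of `⟨d⟩` with index `k`. -/
noncomputable def arcRep (d : G) (k : ℕ) : G :=
  if h : k < Nat.card (G ⧸ AddSubgroup.zmultiples d) then
    ((Finite.equivFin (G ⧸ AddSubgroup.zmultiples d)).symm ⟨k, h⟩).out
  else 0

/-- `arcKey < [G : ⟨d⟩]`. [folklore] -/
theorem arcKey_lt (d c : G) : arcKey d c < Nat.card (G ⧸ AddSubgroup.zmultiples d) := Fin.isLt _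

/-- The representative of the coset of `c`. [folklore] -/
theorem arcRep_arcKey (d c : G) :
    arcRep d (arcKey d c) = (QuotientAddGroup.mk c : G ⧸ AddSubgroup.zmultiples d).out := by
  unfold arcRep arcKey
  rw [dif_pos (Fin.isLt _)]
  simp only [Fin.eta, Equiv.symm_apply_apply]

/-- Every `c` sits at a position `n < ord(d)` of its coset: `c = rep + n•d`. [folklore] -/
theorem exists_arcPos (d c : G) : ∃ n : ℕ, n < addOrderOf d ∧ c = arcRep d (arcKey d c) + n • d := by
  rw [arcRep_arcKey]
  obtain ⟨h, hh⟩ := QuotientAddGroup.mk_out_eq_mul (AddSubgroup.zmultiples d) c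
  obtain ⟨z, hz⟩ := AddSubgroup.mem_zmultiples_iff.1 h.2
  have ho : (0 : ℤ) < (addOrderOf d : ℤ) := by exact_mod_cast addOrderOf_pos d
  have h1 := Int.emod_lt_of_pos (-z) ho
  have h2 := Int.emod_nonneg (-z) ho.ne'
  refine ⟨((-z) % (addOrderOf d : ℤ)).toNat, by omega, ?_⟩
  rw [hh, ← natCast_zsmul, Int.toNat_of_nonneg h2, mod_addOrderOf_zsmul, neg_zsmul, hz]
  abel

/-- The position of `c` in its coset. -/
noncomputable def arcPos (d c : G) : ℕ := Classical.choose (exists_arcPos d c)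

/-- `arcPos < ord(d)`. [folklore] -/
theorem arcPos_lt (d c : G) : arcPos d c < addOrderOf d := (Classical.choose_spec (exists_arcPos d c)).1

/-- `rep + arcPos • d = c`. [folklore] -/
theorem arcRep_add_arcPos (d c : G) : arcRep d (arcKey d c) + arcPos d c • d = c :=
  (Classical.choose_spec (exists_arcPos d c)).2.symm

/-- The UNROLLED SEQUENCE: the cosets of `⟨d⟩` laid out one after the other, each on a stretch of `3·ord(d)` naturals, read along
`d`. -/
noncomputable def arcSeq (b : G → (Fin 2 → ℝ)) (d : G) (J : ℕ) : Fin 2 → ℝ :=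
  b (arcRep d (J / (3 * addOrderOf d)) + (J % (3 * addOrderOf d)) • d)

/-- The start of the window of the unrolled sequence met by the translate with base point `c`. -/
noncomputable def arcStart (d : G) (m : ℕ) (c : G) : ℕ :=
  3 * addOrderOf d * arcKey d c + (arcPos d c + addOrderOf d + 1 - m)

/-- The window of length `m` starting at `arcStart c` lists the points `b(c − i•d)`, `i < m`. [folklore] -/
theorem arcSeq_arcStart (b : G → (Fin 2 → ℝ)) (d : G) {m : ℕ} (hm : m ≤ addOrderOf d) (c : G) {i : ℕ}
    (hi : i < m) : arcSeq b d (arcStart d m c + (m - 1 - i)) = b (c - i • d) := by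
  have hop : 0 < addOrderOf d := addOrderOf_pos d
  have hn : arcPos d c < addOrderOf d := arcPos_lt d c
  unfold arcSeq arcStart
  have hJ : 3 * addOrderOf d * arcKey d c + (arcPos d c + addOrderOf d + 1 - m) + (m - 1 - i) =
      (arcPos d c + addOrderOf d - i) + 3 * addOrderOf d * arcKey d c := by omega
  rw [hJ, Nat.add_mul_div_left _ _ (by omega : 0 < 3 * addOrderOf d), Nat.add_mul_mod_self_left,
    Nat.div_eq_of_lt (by omega : arcPos d c + addOrderOf d - i < 3 * addOrderOf d),
    Nat.mod_eq_of_lt (by omega : arcPos d c + addOrderOf d - i < 3 * addOrderOf d), zero_add]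
  congr 1
  have hsplit : (arcPos d c + addOrderOf d - i) • d + i • d = arcPos d c • d := by
    rw [← add_nsmul, show arcPos d c + addOrderOf d - i + i = arcPos d c + addOrderOf d by omega, add_nsmul,
      addOrderOf_nsmul_eq_zero, add_zero]
  rw [eq_sub_iff_add_eq, add_assoc, hsplit, arcRep_add_arcPos]

/-- Window starts stay below `3·ord(d)·[G : ⟨d⟩] = 3|G|`. [folklore] -/
theorem arcStart_lt (d : G) (m : ℕ) (c : G) :
    arcStart d m c < 3 * addOrderOf d * Nat.card (G ⧸ AddSubgroup.zmultiples d) := by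
  unfold arcStart
  have hk := arcKey_lt d c
  have hn := arcPos_lt d c
  have h1 : 3 * addOrderOf d * (arcKey d c + 1) ≤ 3 * addOrderOf d * Nat.card (G ⧸ AddSubgroup.zmultiples d) :=
    Nat.mul_le_mul_left _ hk
  rw [mul_add, mul_one] at h1
  omega

/-- Lagrange: `[G : ⟨d⟩]·ord(d) = |G|`. [folklore] -/
theorem card_quotient_mul_addOrderOf (d : G) :
    Nat.card (G ⧸ AddSubgroup.zmultiples d) * addOrderOf d = Fintype.card G := by
  rw [← Nat.card_zmultiples d, ← AddSubgroup.card_eq_card_quotient_mul_card_addSubgroup, Nat.card_eq_fintype_card]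

end ArcCosets

section Arc

variable {G : Type*} [AddCommGroup G] [Fintype G] [DecidableEq G]

/-- **The fibre union over a cyclic arc is a union of translated windows OF ONE LENGTH of the unrolled sequence.** [folklore] -/
theorem unionPts_cycArc_eq (a b : G → (Fin 2 → ℝ)) (t d : G) {m : ℕ} (hm : m ≤ addOrderOf d) (s : G) :
    unionPts a b (cycArc t d m : Set G) s =
      ⋃ x : G, (a x +ᵥ (arcSeq b d '' Set.Ico (arcStart d m (s - x - t)) (arcStart d m (s - x - t) + m))) := by
  ext p
  rw [mem_unionPts]
  simp only [Set.mem_iUnion]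
  constructor
  · rintro ⟨x, y, hZ, rfl⟩
    rw [Finset.mem_coe, mem_cycArc] at hZ
    obtain ⟨i, hi, hiy⟩ := hZ
    refine ⟨x, ?_⟩
    rw [Set.mem_vadd_set]
    refine ⟨b y, ⟨arcStart d m (s - x - t) + (m - 1 - i), ⟨Nat.le_add_right _ _, by omega⟩, ?_⟩, vadd_eq_add _ _⟩
    rw [arcSeq_arcStart b d hm (s - x - t) hi]
    congr 1
    rw [← sub_add_eq_sub_sub, hiy]
    abel
  · rintro ⟨x, hp⟩
    rw [Set.mem_vadd_set] at hp
    obtain ⟨z, ⟨J, ⟨hJ1, hJ2⟩, rfl⟩, rfl⟩ := hp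
    obtain ⟨j, rfl⟩ : ∃ j, J = arcStart d m (s - x - t) + j := ⟨J - arcStart d m (s - x - t), by omega⟩
    have hj : j < m := by omega
    refine ⟨x, (s - x - t) - (m - 1 - j) • d, ?_, ?_⟩
    · rw [Finset.mem_coe, mem_cycArc]
      exact ⟨m - 1 - j, by omega, by abel⟩
    · rw [vadd_eq_add]
      congr 1
      have h := arcSeq_arcStart b d hm (s - x - t) (i := m - 1 - j) (by omega)
      rw [show m - 1 - (m - 1 - j) = j by omega] at h
      exact h

/-- **THE ARC UNION BOUND in an arbitrary finite abelian group:** `#vert conv U_s({t, t+d, …, t+(m−1)d}) ≤ 40·|G|` for all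
`a b : G → ℝ²`, every arc of any step `d`, every class `s`.  (For `G = ℤ/q`, `d = 1` this is the interval union bound with a
slightly worse constant; for `d` of any order it covers arithmetic progressions of arbitrary step.) -/
theorem unionVert_cycArc_le (a b : G → (Fin 2 → ℝ)) (t d : G) (m : ℕ) (s : G) :
    unionVert a b (cycArc t d m : Set G) s ≤ 40 * Fintype.card G := by
  have hop : 0 < addOrderOf d := addOrderOf_pos d
  -- reduce to arcs of at most `ord(d)` steps
  wlog hm : m ≤ addOrderOf d generalizing m
  · have h := this (addOrderOf d) le_rfl
    rwa [← cycArc_eq_of_le t d (le_of_not_ge hm) hop] at h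
  unfold unionVert
  rw [unionPts_cycArc_eq a b t d hm s]
  have hmain := ncard_extremePoints_windows_le_linear (arcSeq b d) a (fun x => arcStart d m (s - x - t)) m
    (3 * addOrderOf d * Nat.card (G ⧸ AddSubgroup.zmultiples d)) (fun x => arcStart_lt d m _)
  have hN : 3 * addOrderOf d * Nat.card (G ⧸ AddSubgroup.zmultiples d) = 3 * Fintype.card G := by
    rw [mul_assoc, mul_comm (addOrderOf d), card_quotient_mul_addOrderOf]
  rw [hN] at hmain
  have h1 : m * (3 * Fintype.card G / m) ≤ 3 * Fintype.card G := Nat.mul_div_le _ _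
  have h2 : 8 * m * (3 * Fintype.card G / m + 1) = 8 * (m * (3 * Fintype.card G / m)) + 8 * m := by ring
  have h3 : m ≤ Fintype.card G := hm.trans (addOrderOf_le_card_univ (x := d))
  omega

/-- … and in total over the classes: `≤ 40·|G|²`. -/
theorem unionTotal_cycArc_le (a b : G → (Fin 2 → ℝ)) (t d : G) (m : ℕ) :
    unionTotal a b (cycArc t d m : Set G) ≤ 40 * Fintype.card G ^ 2 := by
  unfold unionTotal
  calc ∑ s, unionVert a b (cycArc t d m : Set G) s ≤ ∑ _s : G, 40 * Fintype.card G :=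
        Finset.sum_le_sum fun s _ => unionVert_cycArc_le a b t d m s
    _ = 40 * Fintype.card G ^ 2 := by rw [Finset.sum_const, Finset.card_univ, smul_eq_mul]; ring

/-- **The `n = 3` law on the ARC-VALUED third-curve stratum of an arbitrary finite abelian group, POINTWISE:** if every level set of
`c` is a cyclic arc (any base point, any step) and `c` takes `≤ k` values, then `V_s ≤ 40·k·|G|` for every class, `a, b` ARBITRARY. -/
theorem classVert_le_of_arc_levels (a b c : G → (Fin 2 → ℝ)) [DecidableEq (Fin 2 → ℝ)]
    (hc : ∀ v, ∃ (t d : G) (m : ℕ), c ⁻¹' {v} = (cycArc t d m : Set G)) {k : ℕ} (hk : (Finset.univ.image c).card ≤ k) (s : G) :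
    classVert a b c s ≤ 40 * k * Fintype.card G := by
  calc classVert a b c s ≤ ∑ v ∈ Finset.univ.image c, unionVert a b (c ⁻¹' {v}) s := classVert_le_sum_unionVert a b c s
    _ ≤ ∑ _v ∈ Finset.univ.image c, 40 * Fintype.card G :=
        Finset.sum_le_sum fun v _ => by
          obtain ⟨t, d, m, h⟩ := hc v
          rw [h]
          exact unionVert_cycArc_le a b t d m s
    _ ≤ 40 * k * Fintype.card G := by
        rw [Finset.sum_const, smul_eq_mul]
        calc (Finset.univ.image c).card * (40 * Fintype.card G) ≤ k * (40 * Fintype.card G) :=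
            Nat.mul_le_mul_right _ hk
          _ = 40 * k * Fintype.card G := by ring

/-- **… and in TOTAL:** `T(a, b, c) ≤ 40·k·|G|²` on the arc-valued third-curve stratum with `≤ k` values, `a, b` arbitrary. -/
theorem totalVert_le_of_arc_levels (a b c : G → (Fin 2 → ℝ)) [DecidableEq (Fin 2 → ℝ)]
    (hc : ∀ v, ∃ (t d : G) (m : ℕ), c ⁻¹' {v} = (cycArc t d m : Set G)) {k : ℕ} (hk : (Finset.univ.image c).card ≤ k) :
    totalVert a b c ≤ 40 * k * Fintype.card G ^ 2 := by
  unfold totalVert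
  calc ∑ s, classVert a b c s ≤ ∑ _s : G, 40 * k * Fintype.card G :=
        Finset.sum_le_sum fun s _ => classVert_le_of_arc_levels a b c hc hk s
    _ = 40 * k * Fintype.card G ^ 2 := by rw [Finset.sum_const, Finset.card_univ, smul_eq_mul]; ring

end Arc

end TotalsLaw

end Summit.ValiantsHypothesis.ValiantsHypothesis.Theorems.NewtonUnitEquationsDissociatedUniform
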